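import Mathlib.Analysis.Calculus.FDeriv.Symmetric
import Mathlib.Analysis.Calculus.MeanValue
import Mathlib.Analysis.Calculus.BumpFunction.FiniteDimension
import Mathlib.Analysis.Calculus.BumpFunction.Normed
import Mathlib.Analysis.SpecialFunctions.Complex.Circle
import Mathlib.MeasureTheory.Integral.IntervalIntegral.FundThmCalculus
import Mathlib.Topology.UniformSpace.HeineCantor
import Literature.Analysis.Calculus.HadamardLemma
import HarnessLib

/-!
# Translation-quasi-invariant finite-order functionals on test functions factor through the
# twisted fibre integral

Topic `Analysis/Distribution`; namespace `Literature.Analysis.Distribution`. Let `X` be a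
finite-dimensional real normed space, `v ∈ X` and `φ : X →L[ℝ] ℝ` with `φ v = 1` (so that
`X = ℝ v ⊕ ker φ`, `x = (φ x) v + (x - (φ x) v)`). A **test function** is a smooth compactly supported
`f : X → ℂ` (`IsTestFn`), and a **finite-order functional** `D` is a linear functional on test functions
such that for every compact `κ` there are `C` and finitely many *words* `w = [a₁, …, a_k]` of vectors
with `|D f| ≤ C · max_w sup |∂_{a₁} ⋯ ∂_{a_k} f|` for `f` supported in `κ` (`IsFiniteOrder`; the
continuity of a distribution on `C_c^∞(κ)`, with nested directional derivatives `vecWordDeriv`).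
The main result (`apply_eq_apply_reinsert` below, brick (FACT)) is the structure theorem for functionals
quasi-invariant under the translations `x ↦ x - t v`:

  if `D (f(· - t v)) = e^{i λ t} D f` for all `t`, then `D f = D (x ↦ ρ_λ(φ x) · A f (x - (φ x) v))`,
  `A f (y) = ∫ e^{i λ s} f (s v + y) ds`, for a fixed bump `ρ` of integral one (`ρ_λ = e^{-iλ·} ρ`) —

i.e. `D` factors through the twisted fibre integral `A` along `ℝ v`. This file proves the two analytic
inputs and the assembly:

* (DIFF) `hasDerivAt_apply_translate` — `t ↦ D (f(· - t v))` is differentiable at `0` with derivative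
  `-D (∂_v f)`: the difference quotients `(f(· - t v) - f)/t + ∂_v f` tend to `0` with all nested
  directional derivatives, uniformly (`∂_w` commutes with translations and — by the symmetry of second
  derivatives of smooth functions, `ContDiffAt.isSymmSndFDerivAt` — with `∂_v`; then the mean value
  inequality for the uniformly continuous `∂_v ∂_w f`);
* (PRIM) `exists_vecDeriv_eq_of_integral_eq_zero` — a test function all of whose integrals along the
  lines `y + ℝ v` vanish is `∂_v` of a test function (`G x = ∫_{a}^{φ x} g(s v + x - (φ x) v) ds`, smooth by
  differentiation under the integral sign, compactly supported because the total integrals vanish);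
* (FACT) `apply_eq_apply_reinsert`.

This is Hörmander, *ALPDO I*, Thm. 3.1.4 (`u' = 0 ⟹ u = C` on `ℝ`: a test function `ψ` with `∫ ψ = 0` is
`φ'` with `φ(x) = ∫_{-∞}^x ψ`, and `u(ψ) = u(ψ - I(ψ)ψ₀) + I(ψ) u(ψ₀)`) and Thm. 3.1.4' (`∂_n u = 0` on
`Y × I ⟹ u(φ) = ∫ u₀(φ(·, x_n)) dx_n`), conjugated by the exponential `e^{iλ φ}` as in Cor. 3.1.5 (there
`E = exp ∫ a`), for functionals continuous in the sense of Def. 2.1.1 — written with nested directional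
derivatives so as to apply verbatim to the quasi-invariant distributions on `GL_n(K_∞)` of
`Literature.NumberTheory.Automorphic.IsArchDistribution`. Everything is proved; the definitions
(`IsTestFn`, `vecDeriv`, `vecWordDeriv`, `IsFiniteOrder`, `translate`, `linePrimitive`, `twistFn`,
`fibreIntegral`, `stdBump`, `reinsert`) have bodies; no named fact.

## References

* L. Hörmander, *The Analysis of Linear Partial Differential Operators I. Distribution Theory and Fourier
  Analysis*, Grundlehren 256, Springer (1983; Classics in Mathematics reprint 2003, same numbering),
  Def. 2.1.1, Thm. 2.1.3, Thm. 3.1.4, Thm. 3.1.4', Cor. 3.1.5 [HormanderALPDO1].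
* L. Schwartz, *Théorie des distributions*, Hermann (1966), Ch. II §§5–6 (the original source of
  `T' = 0 ⟹ T = C` and `∂T/∂x = 0 ⟹ T = 1_x ⊗ S`).
-/

noncomputable section

open MeasureTheory Set Filter Topology Function
open scoped ContDiff ComplexConjugate

namespace Literature.Analysis.Distribution

variable {X : Type*} [NormedAddCommGroup X] [NormedSpace ℝ X]

/-! ### 1. Test functions, directional derivatives, words, finite-order functionals -/

/-- **Test functions**: smooth complex functions of compact support on `X`. [folklore] -/
structure IsTestFn (f : X → ℂ) : Prop where
  /-- smoothness -/
  contDiff : ContDiff ℝ ∞ f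
  /-- compact support -/
  hasCompactSupport : HasCompactSupport f

/-- **The directional derivative** `∂_v f (x) = Df(x) v`. [folklore] -/
def vecDeriv (v : X) (f : X → ℂ) (x : X) : ℂ := fderiv ℝ f x v

/-- **Nested directional derivatives along a word**: `∂_[a₁,…,a_k] f = ∂_{a₁} (⋯ (∂_{a_k} f))`. [folklore] -/
def vecWordDeriv : List X → (X → ℂ) → (X → ℂ)
  | [], f => f
  | a :: w, f => vecDeriv a (vecWordDeriv w f)

/-- `∂_[] f = f`. [folklore] -/
@[simp] theorem vecWordDeriv_nil (f : X → ℂ) : vecWordDeriv [] f = f := rfl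

/-- `∂_(a :: w) f = ∂_a (∂_w f)`. [folklore] -/
@[simp] theorem vecWordDeriv_cons (a : X) (w : List X) (f : X → ℂ) :
    vecWordDeriv (a :: w) f = vecDeriv a (vecWordDeriv w f) := rfl

/-- `∂_(w ++ [a]) f = ∂_w (∂_a f)`. [folklore] -/
theorem vecWordDeriv_append_singleton (w : List X) (a : X) (f : X → ℂ) :
    vecWordDeriv (w ++ [a]) f = vecWordDeriv w (vecDeriv a f) := by
  induction w with
  | nil => rfl
  | cons b w ih => rw [List.cons_append, vecWordDeriv_cons, ih, vecWordDeriv_cons]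

/-- **Finite-order functionals** (the continuity of a distribution on each `C_c^∞(κ)`): for every
compact `κ` there are `C ≥ 0` and a finite set `𝒮` of words such that `|D f| ≤ C · M` whenever `f` is a
test function supported in `κ` with `|∂_w f| ≤ M` for all `w ∈ 𝒮` (Hörmander, Def. 2.1.1:
`|u(φ)| ≤ C Σ_{|α| ≤ k} sup |∂^α φ|`, `φ ∈ C_0^∞(K)`; here with nested directional derivatives along
arbitrary words, an equivalent family of seminorms). [cite: HormanderALPDO1, Def. 2.1.1] -/
def IsFiniteOrder (D : (X → ℂ) → ℂ) : Prop :=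
  ∀ κ : Set X, IsCompact κ → ∃ (C : ℝ) (𝒮 : Finset (List X)), 0 ≤ C ∧
    ∀ f : X → ℂ, IsTestFn f → tsupport f ⊆ κ →
      ∀ M : ℝ, (∀ w ∈ 𝒮, ∀ x, ‖vecWordDeriv w f x‖ ≤ M) → ‖D f‖ ≤ C * M

/-- **Translation** `(τ_u f)(x) = f(x - u)`. [folklore] -/
def translate (u : X) (f : X → ℂ) (x : X) : ℂ := f (x - u)

omit [NormedSpace ℝ X] in
/-- `τ_u f (x) = f (x - u)`. [folklore] -/
@[simp] theorem translate_apply (u : X) (f : X → ℂ) (x : X) : translate u f x = f (x - u) := rfl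

namespace IsTestFn

variable {f g : X → ℂ}

/-- `0` is a test function. [folklore] -/
theorem zero : IsTestFn (0 : X → ℂ) := ⟨contDiff_const, HasCompactSupport.zero⟩

/-- Sums of test functions are test functions. [folklore] -/
theorem add (hf : IsTestFn f) (hg : IsTestFn g) : IsTestFn (f + g) :=
  ⟨hf.contDiff.add hg.contDiff, hf.hasCompactSupport.add hg.hasCompactSupport⟩

/-- Scalar multiples of test functions are test functions. [folklore] -/
theorem smul (hf : IsTestFn f) (c : ℂ) : IsTestFn (c • f) :=
  ⟨contDiff_const.smul hf.contDiff, hf.hasCompactSupport.smul_left⟩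

/-- `-f` is a test function. [folklore] -/
theorem neg (hf : IsTestFn f) : IsTestFn (-f) := by simpa using hf.smul (-1)

/-- Differences of test functions are test functions. [folklore] -/
theorem sub (hf : IsTestFn f) (hg : IsTestFn g) : IsTestFn (f - g) := by
  simpa [sub_eq_add_neg] using hf.add hg.neg

/-- Products with smooth functions are test functions. [folklore] -/
theorem mul_left (hf : IsTestFn f) {h : X → ℂ} (hh : ContDiff ℝ ∞ h) : IsTestFn (fun x => h x * f x) :=
  ⟨hh.mul hf.contDiff, hf.hasCompactSupport.mul_left⟩

/-- Translates of test functions are test functions. [folklore] -/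
theorem translate (hf : IsTestFn f) (u : X) : IsTestFn (translate u f) :=
  ⟨hf.contDiff.comp (contDiff_id.sub contDiff_const),
    by
      have h := hf.hasCompactSupport.comp_homeomorph (Homeomorph.subRight u)
      exact h⟩

/-- Directional derivatives of test functions are test functions. [folklore] -/
theorem vecDeriv (hf : IsTestFn f) (v : X) : IsTestFn (vecDeriv v f) := by
  refine ⟨?_, ?_⟩
  · have h1 : ContDiff ℝ ∞ (fderiv ℝ f) := hf.contDiff.fderiv_right (m := ∞) (by simp)
    exact h1.clm_apply contDiff_const
  · exact hf.hasCompactSupport.fderiv_apply (𝕜 := ℝ) v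

/-- Word derivatives of test functions are test functions. [folklore] -/
theorem vecWordDeriv (hf : IsTestFn f) : ∀ w : List X, IsTestFn (vecWordDeriv w f)
  | [] => hf
  | a :: w => (vecWordDeriv hf w).vecDeriv a

end IsTestFn

/-- `tsupport (∂_v f) ⊆ tsupport f`. [folklore] -/
theorem tsupport_vecDeriv_subset (v : X) (f : X → ℂ) : tsupport (vecDeriv v f) ⊆ tsupport f :=
  tsupport_fderiv_apply_subset ℝ v

/-- `tsupport (∂_w f) ⊆ tsupport f`. [folklore] -/
theorem tsupport_vecWordDeriv_subset (f : X → ℂ) : ∀ w : List X, tsupport (vecWordDeriv w f) ⊆ tsupport f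
  | [] => subset_rfl
  | a :: w => (tsupport_vecDeriv_subset a _).trans (tsupport_vecWordDeriv_subset f w)

omit [NormedSpace ℝ X] in
/-- `tsupport (τ_u f) ⊆ tsupport f + u`. [folklore] -/
theorem tsupport_translate_subset (u : X) (f : X → ℂ) : tsupport (translate u f) ⊆ (fun x => x + u) '' tsupport f := by
  have hhomeo : (fun x : X => x + u) = Homeomorph.addRight u := rfl
  have hsupp : support (translate u f) ⊆ (fun x => x + u) '' tsupport f := fun x hx =>
    ⟨x - u, subset_tsupport _ hx, sub_add_cancel x u⟩
  have hclosed : IsClosed ((fun x : X => x + u) '' tsupport f) := by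
    rw [hhomeo]; exact (Homeomorph.addRight u).isClosed_image.2 (isClosed_tsupport f)
  exact closure_minimal hsupp hclosed

/-! ### 2. `∂_v` is linear and commutes with translations and with the word derivatives -/

/-- `∂_v (τ_u f) = τ_u (∂_v f)`. [folklore] -/
theorem vecDeriv_translate (v u : X) (f : X → ℂ) : vecDeriv v (translate u f) = translate u (vecDeriv v f) := by
  funext x
  simp only [vecDeriv, translate_apply]
  have h : (fun x => f (x - u)) = fun x => f (x + -u) := by funext y; rw [sub_eq_add_neg]
  change fderiv ℝ (fun x => f (x - u)) x v = fderiv ℝ f (x - u) v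
  rw [h, fderiv_comp_add_right, ← sub_eq_add_neg]

/-- `∂_w (τ_u f) = τ_u (∂_w f)`. [folklore] -/
theorem vecWordDeriv_translate (u : X) (f : X → ℂ) : ∀ w : List X, vecWordDeriv w (translate u f) = translate u (vecWordDeriv w f)
  | [] => rfl
  | a :: w => by rw [vecWordDeriv_cons, vecWordDeriv_translate u f w, vecDeriv_translate, vecWordDeriv_cons]

/-- `∂_v (f + g) = ∂_v f + ∂_v g` for differentiable `f, g`. [folklore] -/
theorem vecDeriv_add {f g : X → ℂ} (hf : Differentiable ℝ f) (hg : Differentiable ℝ g) (v : X) :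
    vecDeriv v (f + g) = vecDeriv v f + vecDeriv v g := by
  funext x
  simp only [vecDeriv, Pi.add_apply]
  rw [fderiv_add (hf x) (hg x)]; rfl

/-- `∂_v (c • f) = c • ∂_v f`. [folklore] -/
theorem vecDeriv_smul (c : ℂ) (f : X → ℂ) (v : X) : vecDeriv v (c • f) = c • vecDeriv v f := by
  funext x
  simp only [vecDeriv, Pi.smul_apply]
  rw [fderiv_const_smul_field]
  rfl

/-- `∂_w (f + g) = ∂_w f + ∂_w g` for test functions. [folklore] -/
theorem vecWordDeriv_add {f g : X → ℂ} (hf : IsTestFn f) (hg : IsTestFn g) :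
    ∀ w : List X, vecWordDeriv w (f + g) = vecWordDeriv w f + vecWordDeriv w g
  | [] => rfl
  | a :: w => by
    rw [vecWordDeriv_cons, vecWordDeriv_add hf hg w, vecWordDeriv_cons, vecWordDeriv_cons]
    exact vecDeriv_add ((hf.vecWordDeriv w).contDiff.differentiable (by simp))
      ((hg.vecWordDeriv w).contDiff.differentiable (by simp)) a

/-- `∂_w (c • f) = c • ∂_w f`. [folklore] -/
theorem vecWordDeriv_smul (c : ℂ) (f : X → ℂ) : ∀ w : List X, vecWordDeriv w (c • f) = c • vecWordDeriv w f
  | [] => rfl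
  | a :: w => by rw [vecWordDeriv_cons, vecWordDeriv_smul c f w, vecDeriv_smul, vecWordDeriv_cons]

/-- **Directional derivatives of smooth functions commute**: `∂_a (∂_b f) = ∂_b (∂_a f)` (symmetry of the
second derivative, `ContDiffAt.isSymmSndFDerivAt`). [folklore] -/
theorem vecDeriv_comm {f : X → ℂ} (hf : ContDiff ℝ ∞ f) (a b : X) : vecDeriv a (vecDeriv b f) = vecDeriv b (vecDeriv a f) := by
  funext x
  have hsym : IsSymmSndFDerivAt ℝ f x :=
    hf.contDiffAt.isSymmSndFDerivAt (by
      rw [minSmoothness_of_isRCLikeNormedField]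
      exact WithTop.coe_le_coe.2 le_top)
  have hdf : Differentiable ℝ (fderiv ℝ f) := (hf.fderiv_right (m := ∞) (by simp)).differentiable (by simp)
  have key : ∀ c d : X, vecDeriv c (vecDeriv d f) x = fderiv ℝ (fderiv ℝ f) x c d := by
    intro c d
    change fderiv ℝ (fun y => (fderiv ℝ f y) d) x c = _
    rw [fderiv_clm_apply (hdf x) (differentiableAt_const d)]
    simp
  rw [key, key, hsym a b]

/-- **`∂_v` commutes with the word derivatives of a smooth function**: `∂_w (∂_v f) = ∂_v (∂_w f)`.
[folklore] -/
theorem vecWordDeriv_vecDeriv {f : X → ℂ} (hf : IsTestFn f) (v : X) :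
    ∀ w : List X, vecWordDeriv w (vecDeriv v f) = vecDeriv v (vecWordDeriv w f)
  | [] => rfl
  | a :: w => by
    rw [vecWordDeriv_cons, vecWordDeriv_vecDeriv hf v w, vecWordDeriv_cons]
    exact vecDeriv_comm (hf.vecWordDeriv w).contDiff a v

/-! ### 3. (DIFF) Differentiating the translates: `d/dt D(τ_{t v} f)|₀ = -D(∂_v f)` -/

section Diff

/-- **The flow derivative of a smooth function along `v`**: `s ↦ F(x - s v)` has derivative
`-(∂_v F)(x - s v)`. [folklore] -/
theorem hasDerivAt_translate_line {F : X → ℂ} (hF : Differentiable ℝ F) (v x : X) (s : ℝ) :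
    HasDerivAt (fun s : ℝ => F (x - s • v)) (-(vecDeriv v F (x - s • v))) s := by
  have hγ : HasDerivAt (fun s : ℝ => x - s • v) (-v) s := by
    have h := ((hasDerivAt_id s).smul_const v).const_sub x
    simpa using h
  have h := (hF (x - s • v)).hasFDerivAt.comp_hasDerivAt s hγ
  have h2 : (fderiv ℝ F (x - s • v)) (-v) = -(vecDeriv v F (x - s • v)) := by simp [vecDeriv]
  rw [h2] at h
  exact h

/-- **Uniform convergence of the difference quotients**: for a test function `F`,
`‖(F(x - t v) - F(x))/t + ∂_v F(x)‖ ≤ ε` for `0 < |t| ≤ δ`, uniformly in `x` (mean value inequality and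
uniform continuity of the compactly supported `∂_v F`). [folklore] -/
theorem exists_forall_norm_diffQuot_le {F : X → ℂ} (hF : IsTestFn F) (v : X) {ε : ℝ} (hε : 0 < ε) :
    ∃ δ > (0 : ℝ), ∀ t : ℝ, t ≠ 0 → |t| ≤ δ → ∀ x : X,
      ‖(F (x - t • v) - F x) / (t : ℂ) + vecDeriv v F x‖ ≤ ε := by
  have hF1 : Differentiable ℝ F := hF.contDiff.differentiable (by simp)
  have hdF : IsTestFn (vecDeriv v F) := hF.vecDeriv v
  -- uniform continuity of `∂_v F`
  have huc : UniformContinuous (vecDeriv v F) :=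
    hdF.hasCompactSupport.uniformContinuous_of_continuous hdF.contDiff.continuous
  obtain ⟨η, hη, hηε⟩ := Metric.uniformContinuous_iff.1 huc ε hε
  refine ⟨η / (‖v‖ + 1), div_pos hη (by positivity), fun t ht htδ x => ?_⟩
  -- the auxiliary function `G(s) = F(x - s v) + s ∂_v F(x)` on the segment from `0` to `t`
  have hclose : ∀ s : ℝ, |s| ≤ |t| → ‖vecDeriv v F (x - s • v) - vecDeriv v F x‖ ≤ ε := by
    intro s hs
    rw [← dist_eq_norm]
    refine (hηε ?_).le
    rw [dist_eq_norm, sub_sub_cancel_left, norm_neg, norm_smul, Real.norm_eq_abs]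
    calc |s| * ‖v‖ ≤ |t| * ‖v‖ := mul_le_mul_of_nonneg_right hs (norm_nonneg _)
      _ ≤ η / (‖v‖ + 1) * ‖v‖ := mul_le_mul_of_nonneg_right htδ (norm_nonneg _)
      _ < η := by
          rw [div_mul_eq_mul_div, div_lt_iff₀ (by positivity)]
          nlinarith [norm_nonneg v]
  set G : ℝ → ℂ := fun s => F (x - s • v) + (s : ℂ) * vecDeriv v F x with hG
  have hGd : ∀ s, HasDerivAt G (-(vecDeriv v F (x - s • v)) + vecDeriv v F x) s := by
    intro s
    have h1 := hasDerivAt_translate_line hF1 v x s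
    have h2 : HasDerivAt (fun s : ℝ => (s : ℂ) * vecDeriv v F x) (vecDeriv v F x) s := by
      simpa using (Complex.ofRealCLM.hasDerivAt (x := s)).mul_const (vecDeriv v F x)
    exact h1.add h2
  -- mean value inequality on the segment between `0` and `t`
  have hmv : ‖G t - G 0‖ ≤ ε * |t| := by
    have h := (convex_uIcc (0 : ℝ) t).norm_image_sub_le_of_norm_hasDerivWithin_le
      (f := G) (C := ε) (fun s _ => (hGd s).hasDerivWithinAt) (fun s hs => ?_) (left_mem_uIcc) (right_mem_uIcc)
    · simpa only [sub_zero, Real.norm_eq_abs] using h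
    · have hs' : |s| ≤ |t| := by
        have h1 := Set.abs_sub_left_of_mem_uIcc hs
        simpa only [sub_zero] using h1
      calc ‖-vecDeriv v F (x - s • v) + vecDeriv v F x‖
          = ‖vecDeriv v F (x - s • v) - vecDeriv v F x‖ := by
            rw [← norm_neg]; congr 1; ring
        _ ≤ ε := hclose s hs'
  -- divide by `t`
  have hG0 : G 0 = F x := by simp [hG]
  have hGt : G t - G 0 = (t : ℂ) * ((F (x - t • v) - F x) / (t : ℂ) + vecDeriv v F x) := by
    rw [hG0]
    simp only [hG]
    have ht' : (t : ℂ) ≠ 0 := Complex.ofReal_ne_zero.2 ht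
    field_simp
    ring
  rw [hGt, norm_mul, Complex.norm_real, Real.norm_eq_abs] at hmv
  have ht0 : 0 < |t| := abs_pos.2 ht
  nlinarith

/-- The difference quotient of a translate, as a function. [folklore] -/
theorem diffQuot_eq (f : X → ℂ) (v : X) (t : ℝ) :
    (fun x => (translate (t • v) f x - f x) / (t : ℂ) + vecDeriv v f x) =
      (t : ℂ)⁻¹ • (translate (t • v) f - f) + vecDeriv v f := by
  funext x
  simp only [Pi.add_apply, Pi.smul_apply, Pi.sub_apply, translate_apply, smul_eq_mul]
  ring

/-- **(DIFF) The translates are differentiable inside a finite-order functional**: if `D` is additive and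
homogeneous on test functions and of finite order, then for every test function `f`,
`t ↦ D (τ_{t v} f)` has derivative `-D (∂_v f)` at `t = 0` (the difference quotients converge in
`C_0^∞(K)`, Hörmander, Thm. 2.1.3 and the remark before it). [cite: HormanderALPDO1, Thm. 2.1.3] -/
theorem hasDerivAt_apply_translate {D : (X → ℂ) → ℂ}
    (hadd : ∀ f g : X → ℂ, IsTestFn f → IsTestFn g → D (f + g) = D f + D g)
    (hsmul : ∀ (c : ℂ) (f : X → ℂ), IsTestFn f → D (c • f) = c * D f)
    (hD : IsFiniteOrder D) {f : X → ℂ} (hf : IsTestFn f) (v : X) :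
    HasDerivAt (fun t : ℝ => D (translate (t • v) f)) (-D (vecDeriv v f)) 0 := by
  -- a compact set containing the supports of all `τ_{t v} f`, `|t| ≤ 1`, and of `∂_v f`
  set κ : Set X := (fun p : X × ℝ => p.1 + p.2 • v) '' (tsupport f ×ˢ Icc (-1 : ℝ) 1) with hκ
  have hκc : IsCompact κ :=
    (hf.hasCompactSupport.isCompact.prod isCompact_Icc).image (continuous_fst.add (continuous_snd.smul continuous_const))
  have hsub_f : tsupport f ⊆ κ := fun x hx => ⟨(x, 0), ⟨hx, by norm_num, by norm_num⟩, by simp⟩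
  have hsub_t : ∀ t : ℝ, |t| ≤ 1 → tsupport (translate (t • v) f) ⊆ κ := by
    intro t ht x hx
    obtain ⟨y, hy, rfl⟩ := tsupport_translate_subset (t • v) f hx
    exact ⟨(y, t), ⟨hy, abs_le.1 ht⟩, rfl⟩
  obtain ⟨C, 𝒮, hC, hbound⟩ := hD κ hκc
  -- the estimate `‖D(q_t)‖ ≤ C ε` for small `t`
  rw [hasDerivAt_iff_tendsto_slope_zero]
  refine Metric.tendsto_nhdsWithin_nhds.2 fun ε hε => ?_
  -- uniform `δ` for the finitely many words
  have hδw : ∀ w ∈ 𝒮, ∃ δ > (0 : ℝ), ∀ t : ℝ, t ≠ 0 → |t| ≤ δ → ∀ x : X,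
      ‖(vecWordDeriv w f (x - t • v) - vecWordDeriv w f x) / (t : ℂ) + vecDeriv v (vecWordDeriv w f) x‖ ≤
        ε / (2 * (C + 1)) := fun w _ =>
    exists_forall_norm_diffQuot_le (hf.vecWordDeriv w) v (div_pos hε (by positivity))
  classical
  choose! δ hδ0 hδ using hδw
  -- a common `δ₀ ∈ (0, 1]` below all `δ w`
  set δ₀ : ℝ := (insert 1 (𝒮.image δ)).min' (Finset.insert_nonempty _ _) with hδ₀
  have hδ₀pos : 0 < δ₀ := by
    rw [hδ₀, Finset.lt_min'_iff]
    intro y hy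
    rcases Finset.mem_insert.1 hy with rfl | hy
    · exact one_pos
    · obtain ⟨w, hw, rfl⟩ := Finset.mem_image.1 hy
      exact hδ0 w hw
  have hδ₀le1 : δ₀ ≤ 1 := Finset.min'_le _ _ (Finset.mem_insert_self _ _)
  have hδ₀le : ∀ w ∈ 𝒮, δ₀ ≤ δ w := fun w hw =>
    Finset.min'_le _ _ (Finset.mem_insert_of_mem (Finset.mem_image_of_mem δ hw))
  refine ⟨δ₀, hδ₀pos, fun {t} ht hdist => ?_⟩
  have ht0 : t ≠ 0 := ht
  have htδ : |t| < δ₀ := by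
    rwa [dist_zero_right, Real.norm_eq_abs] at hdist
  -- linearity: the slope is `D (q_t)`
  have hsub : ∀ f g : X → ℂ, IsTestFn f → IsTestFn g → D (f - g) = D f - D g := by
    intro f g hf hg
    have h := hadd (f - g) g (hf.sub hg) hg
    rw [sub_add_cancel] at h
    linear_combination -h
  set q : X → ℂ := (t : ℂ)⁻¹ • (translate (t • v) f - f) + vecDeriv v f with hq
  have hτ : IsTestFn (translate (t • v) f) := hf.translate _
  have hqt : IsTestFn q := ((hτ.sub hf).smul _).add (hf.vecDeriv v)
  have hslope : (t⁻¹ : ℝ) • (D (translate (t • v) f) - D (translate ((0 : ℝ) • v) f)) - -D (vecDeriv v f) = D q := by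
    have h0 : translate ((0 : ℝ) • v) f = f := by funext x; simp only [translate_apply, zero_smul, sub_zero]
    rw [h0, hq, hadd _ _ ((hτ.sub hf).smul _) (hf.vecDeriv v), hsmul _ _ (hτ.sub hf), hsub _ _ hτ hf,
      Complex.real_smul, Complex.ofReal_inv]
    ring
  rw [dist_eq_norm]
  simp only [zero_add]
  rw [hslope]
  -- supports
  have hqκ : tsupport q ⊆ κ := by
    refine (tsupport_add _ _).trans (union_subset ?_ ((tsupport_vecDeriv_subset v f).trans hsub_f))
    have hsm : tsupport ((t : ℂ)⁻¹ • (translate (t • v) f - f)) ⊆ tsupport (translate (t • v) f - f) :=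
      tsupport_smul_subset_right (fun _ : X => (t : ℂ)⁻¹) (translate (t • v) f - f)
    refine hsm.trans ?_
    exact (tsupport_sub _ _).trans (union_subset (hsub_t t (htδ.le.trans hδ₀le1)) hsub_f)
  -- the word derivatives of `q`
  have hwq : ∀ w ∈ 𝒮, ∀ x, ‖vecWordDeriv w q x‖ ≤ ε / (2 * (C + 1)) := by
    intro w hw x
    have hlin : vecWordDeriv w q = (t : ℂ)⁻¹ • (translate (t • v) (vecWordDeriv w f) - vecWordDeriv w f) +
        vecDeriv v (vecWordDeriv w f) := by
      rw [hq, vecWordDeriv_add ((hτ.sub hf).smul _) (hf.vecDeriv v) w, vecWordDeriv_smul, sub_eq_add_neg,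
        vecWordDeriv_add hτ hf.neg w, vecWordDeriv_translate, vecWordDeriv_vecDeriv hf v w]
      have hneg : vecWordDeriv w (-f) = -vecWordDeriv w f := by
        have h := vecWordDeriv_smul (-1 : ℂ) f w
        simpa using h
      rw [hneg, ← sub_eq_add_neg]
    rw [hlin]
    have h := hδ w hw t ht0 (htδ.le.trans (hδ₀le w hw)) x
    simpa only [Pi.add_apply, Pi.smul_apply, Pi.sub_apply, translate_apply, smul_eq_mul, div_eq_inv_mul] using h
  calc ‖D q‖ ≤ C * (ε / (2 * (C + 1))) := hbound q hqt hqκ _ hwq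
    _ < ε := by
        rw [mul_div_assoc']
        rw [div_lt_iff₀ (by positivity)]
        nlinarith

end Diff

/-! ### 4. (PRIM) Zero fibre integrals along `ℝ v` ⟹ `∂_v` of a test function -/

section Prim

/-- **The primitive along `v`**: `G(x) = ∫_a^{φ x} g(s v + (x - (φ x) v)) ds`. [folklore] -/
def linePrimitive (v : X) (φ : X →L[ℝ] ℝ) (a : ℝ) (g : X → ℂ) (x : X) : ℂ :=
  ∫ s in a..(φ x), g (s • v + (x - (φ x) • v))

variable (v : X) (φ : X →L[ℝ] ℝ)

/-- The projection `x ↦ x - (φ x) v` onto `ker φ` along `v` is unchanged along the line `x + ℝ v` when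
`φ v = 1`. [folklore] -/
theorem proj_add_smul (hφ : φ v = 1) (x : X) (t : ℝ) :
    (x + t • v) - (φ (x + t • v)) • v = x - (φ x) • v := by
  rw [map_add, map_smul, hφ, smul_eq_mul, mul_one, add_smul]; abel

/-- `φ (s v + (x - (φ x) v)) = s`. [folklore] -/
theorem apply_line (hφ : φ v = 1) (x : X) (s : ℝ) : φ (s • v + (x - (φ x) • v)) = s := by
  rw [map_add, map_sub, map_smul, map_smul, hφ, smul_eq_mul, smul_eq_mul, mul_one, mul_one]; ring

/-- `x = (φ x) v + (x - (φ x) v)`. [folklore] -/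
theorem line_decomp (x : X) : (φ x) • v + (x - (φ x) • v) = x := by abel

/-- **The primitive as a `[0, 1]`-integral** (substitution `s = a + θ (φ x - a)`):
`G(x) = ∫₀¹ (φ x - a) g((a + θ(φ x - a)) v + (x - (φ x) v)) dθ`. [folklore] -/
theorem linePrimitive_eq_integral_unit (a : ℝ) (g : X → ℂ) (x : X) :
    linePrimitive v φ a g x =
      ∫ θ in (0 : ℝ)..1, ((φ x - a : ℝ) : ℂ) * g (((φ x - a) * θ + a) • v + (x - (φ x) • v)) := by
  rw [linePrimitive]
  have h := intervalIntegral.smul_integral_comp_mul_add (a := (0 : ℝ)) (b := 1)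
    (fun s : ℝ => g (s • v + (x - (φ x) • v))) (φ x - a) a
  simp only [mul_zero, zero_add, mul_one, sub_add_cancel] at h
  rw [← h, intervalIntegral.integral_const_mul, Complex.real_smul]

/-- **The primitive is smooth** (differentiation under the integral sign on `[0, 1]`,
`Literature.Analysis.Calculus.contDiff_intervalIntegral`). [folklore] -/
theorem contDiff_linePrimitive [FiniteDimensional ℝ X] (a : ℝ) {g : X → ℂ} (hg : ContDiff ℝ ∞ g) :
    ContDiff ℝ ∞ (linePrimitive v φ a g) := by
  have heq : linePrimitive v φ a g = fun x => ∫ θ in (0 : ℝ)..1,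
      (fun (x : X) (θ : ℝ) => ((φ x - a : ℝ) : ℂ) * g (((φ x - a) * θ + a) • v + (x - (φ x) • v))) x θ :=
    funext fun x => linePrimitive_eq_integral_unit v φ a g x
  rw [heq]
  refine Literature.Analysis.Calculus.contDiff_intervalIntegral ?_ 0 1
  have hφ1 : ContDiff ℝ ∞ fun p : X × ℝ => φ p.1 := φ.contDiff.comp contDiff_fst
  refine ContDiff.mul ?_ ?_
  · exact Complex.ofRealCLM.contDiff.comp (hφ1.sub contDiff_const)
  · refine hg.comp ?_
    exact (((hφ1.sub contDiff_const).mul contDiff_snd).add contDiff_const).smul contDiff_const |>.add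
      (contDiff_fst.sub (hφ1.smul contDiff_const))

/-- **`∂_v G = g`** (fundamental theorem of calculus along the line `x + ℝ v`). [folklore] -/
theorem vecDeriv_linePrimitive [FiniteDimensional ℝ X] (hφ : φ v = 1) (a : ℝ) {g : X → ℂ} (hg : ContDiff ℝ ∞ g) (x : X) :
    vecDeriv v (linePrimitive v φ a g) x = g x := by
  -- along the line: `G(x + t v) = ∫_a^{φ x + t} g(s v + y) ds`
  set y : X := x - (φ x) • v with hy
  have hline : ∀ t : ℝ, linePrimitive v φ a g (x + t • v) = ∫ s in a..(φ x + t), g (s • v + y) := by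
    intro t
    rw [linePrimitive, proj_add_smul v φ hφ, map_add, map_smul, hφ, smul_eq_mul, mul_one]
  have hcont : Continuous fun s : ℝ => g (s • v + y) :=
    hg.continuous.comp ((continuous_id.smul continuous_const).add continuous_const)
  have hftc : HasDerivAt (fun u : ℝ => ∫ s in a..u, g (s • v + y)) (g ((φ x) • v + y)) (φ x) :=
    intervalIntegral.integral_hasDerivAt_right (hcont.intervalIntegrable _ _)
      (hcont.stronglyMeasurableAtFilter _ _) hcont.continuousAt
  have h1 : HasDerivAt (fun t : ℝ => linePrimitive v φ a g (x + t • v)) (g x) 0 := by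
    have h2 : HasDerivAt (fun t : ℝ => ∫ s in a..(φ x + t), g (s • v + y)) (g ((φ x) • v + y)) 0 := by
      have hftc' : HasDerivAt (fun u : ℝ => ∫ s in a..u, g (s • v + y)) (g ((φ x) • v + y)) (φ x + 0) := by
        rw [add_zero]; exact hftc
      exact hftc'.comp_const_add (φ x) 0
    rw [hy, line_decomp] at h2
    refine h2.congr_of_eventuallyEq (Eventually.of_forall fun t => ?_)
    exact hline t
  -- `∂_v G (x) = d/dt G(x + t v)|₀`
  have hGd : Differentiable ℝ (linePrimitive v φ a g) := (contDiff_linePrimitive v φ a hg).differentiable (by simp)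
  have h4 : HasDerivAt (fun t : ℝ => linePrimitive v φ a g (x + t • v)) (vecDeriv v (linePrimitive v φ a g) x) 0 := by
    have hγ : HasDerivAt (fun t : ℝ => x + t • v) v 0 := by
      simpa using ((hasDerivAt_id (0 : ℝ)).smul_const v).const_add x
    have h := (hGd (x + (0 : ℝ) • v)).hasFDerivAt.comp_hasDerivAt (0 : ℝ) hγ
    simp only [zero_smul, add_zero] at h
    exact h
  exact h4.unique h1

/-- **Support of the primitive**: if `a < φ` and `φ < b` on `tsupport g` and all the fibre integrals
`∫ g(s v + y) ds` vanish, then `G` is supported in the compact set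
`{s v + (z - (φ z) v) : s ∈ [a, b], z ∈ tsupport g}`. [folklore] -/
theorem tsupport_linePrimitive_subset (hφ : φ v = 1) {a b : ℝ} {g : X → ℂ} (hg : IsTestFn g)
    (ha : ∀ z ∈ tsupport g, a < φ z) (hb : ∀ z ∈ tsupport g, φ z < b)
    (h0 : ∀ y : X, ∫ s : ℝ, g (s • v + y) = 0) :
    tsupport (linePrimitive v φ a g) ⊆
      (fun p : ℝ × X => p.1 • v + (p.2 - (φ p.2) • v)) '' (Icc a b ×ˢ tsupport g) := by
  set S := (fun p : ℝ × X => p.1 • v + (p.2 - (φ p.2) • v)) '' (Icc a b ×ˢ tsupport g) with hS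
  have hSc : IsCompact S := (isCompact_Icc.prod hg.hasCompactSupport.isCompact).image
    ((continuous_fst.smul continuous_const).add (continuous_snd.sub ((φ.continuous.comp continuous_snd).smul continuous_const)))
  refine closure_minimal (fun x hx => ?_) hSc.isClosed
  rw [mem_support] at hx
  set y : X := x - (φ x) • v with hy
  -- the integrand along the fibre of `x`
  have hvan : ∀ s : ℝ, g (s • v + y) ≠ 0 → a < s ∧ s < b ∧ s • v + y ∈ tsupport g := by
    intro s hs
    have hmem : s • v + y ∈ tsupport g := subset_tsupport _ hs
    have hφs : φ (s • v + y) = s := apply_line v φ hφ x s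
    exact ⟨hφs ▸ ha _ hmem, hφs ▸ hb _ hmem, hmem⟩
  -- `φ x ≤ b`: otherwise `G x` is the (vanishing) total integral
  have hxb : φ x ≤ b := by
    by_contra hlt
    push Not at hlt
    apply hx
    rw [linePrimitive, ← hy]
    have hsupp : support (fun s : ℝ => g (s • v + y)) ⊆ Ioc a (φ x) := fun s hs =>
      ⟨(hvan s hs).1, ((hvan s hs).2.1.trans hlt).le⟩
    rw [intervalIntegral.integral_eq_integral_of_support_subset hsupp, h0 y]
  -- `a ≤ φ x`: otherwise the integrand vanishes on `[φ x, a]`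
  have hax : a ≤ φ x := by
    by_contra hlt
    push Not at hlt
    apply hx
    rw [linePrimitive, ← hy, intervalIntegral.integral_symm, neg_eq_zero]
    refine intervalIntegral.integral_zero_ae (Eventually.of_forall fun s hs => ?_)
    rw [uIoc_of_le hlt.le] at hs
    by_contra hne
    exact absurd (hvan s hne).1 (not_lt.2 hs.2)
  -- some point of the fibre lies in `tsupport g`
  have hex : ∃ s : ℝ, g (s • v + y) ≠ 0 := by
    by_contra hall
    push Not at hall
    apply hx
    rw [linePrimitive, ← hy]
    simp [hall]
  obtain ⟨s, hs⟩ := hex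
  refine ⟨(φ x, s • v + y), ⟨⟨hax, hxb⟩, (hvan s hs).2.2⟩, ?_⟩
  simp only
  rw [apply_line v φ hφ x s]
  have : s • v + y - s • v = y := by abel
  rw [this, hy, line_decomp]

/-- **(PRIM)** A test function all of whose integrals along the lines `y + ℝ v` vanish is the directional
derivative `∂_v G` of a test function `G` (Hörmander, proof of Thm. 3.1.4: on `ℝ`, `φ(x) = ∫_{-∞}^x ψ(t) dt`
is in `C_0^∞` iff `I(ψ) = ∫ ψ = 0`; Thm. 3.1.4' for the version with parameters `Y × I`).
[cite: HormanderALPDO1, Thm. 3.1.4, Thm. 3.1.4' (proofs)] -/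
theorem exists_vecDeriv_eq_of_integral_eq_zero [FiniteDimensional ℝ X] (hφ : φ v = 1) {g : X → ℂ} (hg : IsTestFn g)
    (h0 : ∀ y : X, ∫ s : ℝ, g (s • v + y) = 0) :
    ∃ G : X → ℂ, IsTestFn G ∧ vecDeriv v G = g := by
  obtain ⟨R, hR⟩ := hg.hasCompactSupport.isCompact.exists_bound_of_continuousOn φ.continuous.continuousOn
  have ha : ∀ z ∈ tsupport g, -R - 1 < φ z := fun z hz => by
    have h := (abs_le.1 ((Real.norm_eq_abs _).symm.le.trans (hR z hz))).1; linarith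
  have hb : ∀ z ∈ tsupport g, φ z < R + 1 := fun z hz => by
    have h := (abs_le.1 ((Real.norm_eq_abs _).symm.le.trans (hR z hz))).2; linarith
  refine ⟨linePrimitive v φ (-R - 1) g, ⟨contDiff_linePrimitive v φ _ hg.contDiff, ?_⟩,
    funext fun x => vecDeriv_linePrimitive v φ hφ _ hg.contDiff x⟩
  have hsub := tsupport_linePrimitive_subset v φ hφ hg ha hb h0
  have hSc : IsCompact ((fun p : ℝ × X => p.1 • v + (p.2 - (φ p.2) • v)) '' (Icc (-R - 1) (R + 1) ×ˢ tsupport g)) :=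
    (isCompact_Icc.prod hg.hasCompactSupport.isCompact).image
      ((continuous_fst.smul continuous_const).add
        (continuous_snd.sub ((φ.continuous.comp continuous_snd).smul continuous_const)))
  exact IsCompact.of_isClosed_subset hSc (isClosed_tsupport _) hsub

end Prim

/-! ### 5. (FACT) Quasi-invariant finite-order functionals factor through the twisted fibre integral -/

section Fact

variable (v : X) (φ : X →L[ℝ] ℝ)

/-- **The character twist** `e_c(x) = exp(i c φ(x))`. [folklore] -/
def twistFn (c : ℝ) (x : X) : ℂ := Complex.exp (((c * φ x : ℝ) : ℂ) * Complex.I)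

/-- `e_c` is smooth. [folklore] -/
theorem contDiff_twistFn (c : ℝ) : ContDiff ℝ ∞ (twistFn φ c) := by
  unfold twistFn
  refine Complex.contDiff_exp.comp ?_
  exact (Complex.ofRealCLM.contDiff.comp (contDiff_const.mul φ.contDiff)).mul contDiff_const

/-- `e_c(x) e_{-c}(x) = 1`. [folklore] -/
theorem twistFn_mul_twistFn_neg (c : ℝ) (x : X) : twistFn φ c x * twistFn φ (-c) x = 1 := by
  simp only [twistFn, ← Complex.exp_add]
  convert Complex.exp_zero using 2
  push_cast; ring

/-- `e_c(x) ≠ 0`. [folklore] -/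
theorem twistFn_ne_zero (c : ℝ) (x : X) : twistFn φ c x ≠ 0 := Complex.exp_ne_zero _

/-- `e_c (s v + y) = exp(i c s) e_c(y)`-type evaluation on the line: `e_c(s v + (x - (φ x) v)) = exp(i c s)`.
[folklore] -/
theorem twistFn_line (hφ : φ v = 1) (c : ℝ) (x : X) (s : ℝ) :
    twistFn φ c (s • v + (x - (φ x) • v)) = Complex.exp (((c * s : ℝ) : ℂ) * Complex.I) := by
  rw [twistFn, apply_line v φ hφ]

/-- **`∂_v e_c = i c e_c`** (chain rule, `φ v = 1`). [folklore] -/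
theorem hasDerivAt_twistFn_line (hφ : φ v = 1) (c : ℝ) (x : X) :
    HasDerivAt (fun t : ℝ => twistFn φ c (x + t • v)) (((c : ℝ) : ℂ) * Complex.I * twistFn φ c x) 0 := by
  have hlin : ∀ t : ℝ, twistFn φ c (x + t • v) = Complex.exp ((((c * φ x : ℝ) : ℂ) * Complex.I) + t * (((c : ℝ) : ℂ) * Complex.I)) := by
    intro t
    rw [twistFn, map_add, map_smul, hφ, smul_eq_mul, mul_one]
    congr 1
    push_cast; ring
  simp_rw [hlin]
  have h1 : HasDerivAt (fun t : ℝ => (((c * φ x : ℝ) : ℂ) * Complex.I) + t * (((c : ℝ) : ℂ) * Complex.I))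
      (((c : ℝ) : ℂ) * Complex.I) 0 := by
    have h := (Complex.ofRealCLM.hasDerivAt (x := (0 : ℝ))).mul_const (((c : ℝ) : ℂ) * Complex.I)
    simpa using h.const_add ((((c * φ x : ℝ) : ℂ) * Complex.I))
  have h2 := (Complex.hasDerivAt_exp _).comp (0 : ℝ) h1
  have h3 : Complex.exp ((((c * φ x : ℝ) : ℂ) * Complex.I) + (0 : ℝ) * (((c : ℝ) : ℂ) * Complex.I)) = twistFn φ c x := by
    rw [twistFn]; congr 1; push_cast; simp
  rw [h3] at h2
  refine h2.congr_deriv ?_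
  ring

/-- **`∂_v (e_c h) = e_c (i c h + ∂_v h)`.** [folklore] -/
theorem vecDeriv_twistFn_mul (hφ : φ v = 1) (c : ℝ) {h : X → ℂ} (hh : Differentiable ℝ h) (x : X) :
    vecDeriv v (fun y => twistFn φ c y * h y) x =
      twistFn φ c x * ((((c : ℝ) : ℂ) * Complex.I) * h x + vecDeriv v h x) := by
  -- compute along the line through `x`
  have hprod : Differentiable ℝ fun y => twistFn φ c y * h y :=
    ((contDiff_twistFn φ c).differentiable (by simp)).mul hh
  have hγ : HasDerivAt (fun t : ℝ => x + t • v) v 0 := by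
    simpa using ((hasDerivAt_id (0 : ℝ)).smul_const v).const_add x
  have hL : HasDerivAt (fun t : ℝ => twistFn φ c (x + t • v) * h (x + t • v))
      (vecDeriv v (fun y => twistFn φ c y * h y) x) 0 := by
    have h1 := (hprod (x + (0 : ℝ) • v)).hasFDerivAt.comp_hasDerivAt (0 : ℝ) hγ
    simp only [zero_smul, add_zero] at h1
    exact h1
  have hR : HasDerivAt (fun t : ℝ => twistFn φ c (x + t • v) * h (x + t • v))
      (((c : ℝ) : ℂ) * Complex.I * twistFn φ c x * h x + twistFn φ c x * vecDeriv v h x) 0 := by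
    have hh1 : HasDerivAt (fun t : ℝ => h (x + t • v)) (vecDeriv v h x) 0 := by
      have h1 := (hh (x + (0 : ℝ) • v)).hasFDerivAt.comp_hasDerivAt (0 : ℝ) hγ
      simp only [zero_smul, add_zero] at h1
      exact h1
    have h2 := (hasDerivAt_twistFn_line v φ hφ c x).mul hh1
    simp only [zero_smul, add_zero] at h2
    exact h2
  rw [hL.unique hR]
  ring

/-- **The infinitesimal relation**: `D (∂_v f) = -iλ D f` for a finite-order functional with
`D (τ_{t v} f) = e^{iλt} D f`. [folklore] -/
theorem apply_vecDeriv_eq {D : (X → ℂ) → ℂ}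
    (hadd : ∀ f g : X → ℂ, IsTestFn f → IsTestFn g → D (f + g) = D f + D g)
    (hsmul : ∀ (c : ℂ) (f : X → ℂ), IsTestFn f → D (c • f) = c * D f)
    (hD : IsFiniteOrder D) {lam : ℝ}
    (hq : ∀ f : X → ℂ, IsTestFn f → ∀ t : ℝ,
      D (translate (t • v) f) = Complex.exp (((lam * t : ℝ) : ℂ) * Complex.I) * D f)
    {f : X → ℂ} (hf : IsTestFn f) :
    D (vecDeriv v f) = -((((lam : ℝ) : ℂ) * Complex.I) * D f) := by
  have h1 := hasDerivAt_apply_translate hadd hsmul hD hf v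
  have h2 : HasDerivAt (fun t : ℝ => Complex.exp (((lam * t : ℝ) : ℂ) * Complex.I) * D f)
      ((((lam : ℝ) : ℂ) * Complex.I) * D f) 0 := by
    have ha : HasDerivAt (fun t : ℝ => ((lam * t : ℝ) : ℂ) * Complex.I) (((lam : ℝ) : ℂ) * Complex.I) 0 := by
      have h := ((Complex.ofRealCLM.hasDerivAt (x := (0 : ℝ))).const_mul ((lam : ℝ) : ℂ)).mul_const Complex.I
      have h' : HasDerivAt (fun t : ℝ => ((lam : ℝ) : ℂ) * (t : ℂ) * Complex.I) (((lam : ℝ) : ℂ) * Complex.I) 0 := by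
        refine h.congr_deriv ?_
        simp
      refine h'.congr_of_eventuallyEq (Eventually.of_forall fun t => ?_)
      simp only [Complex.ofReal_mul]
    have hb := ((Complex.hasDerivAt_exp _).comp (0 : ℝ) ha).mul_const (D f)
    simpa using hb
  have heq : (fun t : ℝ => D (translate (t • v) f)) = fun t : ℝ => Complex.exp (((lam * t : ℝ) : ℂ) * Complex.I) * D f :=
    funext fun t => hq f hf t
  rw [heq] at h1
  have h := h1.unique h2
  linear_combination -h

/-- **The twisted functional kills `∂_v`-derivatives**: `D (e_{-λ} ∂_v G) = 0`. [folklore] -/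
theorem apply_twist_vecDeriv_eq_zero {D : (X → ℂ) → ℂ}
    (hadd : ∀ f g : X → ℂ, IsTestFn f → IsTestFn g → D (f + g) = D f + D g)
    (hsmul : ∀ (c : ℂ) (f : X → ℂ), IsTestFn f → D (c • f) = c * D f)
    (hD : IsFiniteOrder D) (hφ : φ v = 1) {lam : ℝ}
    (hq : ∀ f : X → ℂ, IsTestFn f → ∀ t : ℝ,
      D (translate (t • v) f) = Complex.exp (((lam * t : ℝ) : ℂ) * Complex.I) * D f)
    {G : X → ℂ} (hG : IsTestFn G) :
    D (fun x => twistFn φ (-lam) x * vecDeriv v G x) = 0 := by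
  have hGd : Differentiable ℝ G := hG.contDiff.differentiable (by simp)
  have heG : IsTestFn fun x => twistFn φ (-lam) x * G x := hG.mul_left (contDiff_twistFn φ _)
  have h1 := apply_vecDeriv_eq v hadd hsmul hD hq heG
  -- `∂_v (e G) = e (-iλ G + ∂_v G)`, so `D (e ∂_v G) = D(∂_v (e G)) + iλ D(e G) = 0`
  have hsplit : vecDeriv v (fun x => twistFn φ (-lam) x * G x) =
      (-(((lam : ℝ) : ℂ) * Complex.I)) • (fun x => twistFn φ (-lam) x * G x) +
        fun x => twistFn φ (-lam) x * vecDeriv v G x := by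
    funext x
    rw [vecDeriv_twistFn_mul v φ hφ (-lam) hGd x]
    simp only [Pi.add_apply, Pi.smul_apply, smul_eq_mul, Complex.ofReal_neg]
    ring
  have heG' : IsTestFn fun x => twistFn φ (-lam) x * vecDeriv v G x := (hG.vecDeriv v).mul_left (contDiff_twistFn φ _)
  rw [hsplit, hadd _ _ (heG.smul _) heG', hsmul _ _ heG] at h1
  linear_combination h1

/-- **The fibre integral** `A k (x) = ∫ k(s v + (x - (φ x) v)) ds` (constant along the fibres `x + ℝ v`).
[folklore] -/
def fibreIntegral (k : X → ℂ) (x : X) : ℂ := ∫ s : ℝ, k (s • v + (x - (φ x) • v))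

/-- The fibre integral is constant along the fibres: `A k (s v + y) = A k (y)`. [folklore] -/
theorem fibreIntegral_line (hφ : φ v = 1) (k : X → ℂ) (y : X) (s : ℝ) :
    fibreIntegral v φ k (s • v + y) = fibreIntegral v φ k y := by
  unfold fibreIntegral
  have h : s • v + y - (φ (s • v + y)) • v = y - (φ y) • v := by
    rw [map_add, map_smul, hφ, smul_eq_mul, mul_one, add_smul]; abel
  rw [h]

/-- The restriction of a test function to a line `s ↦ k(s v + y)` is continuous with compact support
(`v ≠ 0`). [folklore] -/
theorem hasCompactSupport_line (hφ : φ v = 1) {k : X → ℂ} (hk : IsTestFn k) (y : X) :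
    Continuous (fun s : ℝ => k (s • v + y)) ∧ HasCompactSupport (fun s : ℝ => k (s • v + y)) := by
  have hv : v ≠ 0 := fun h => by rw [h, map_zero] at hφ; exact zero_ne_one hφ
  refine ⟨hk.contDiff.continuous.comp ((continuous_id.smul continuous_const).add continuous_const), ?_⟩
  -- `s ↦ s v + y` is a closed embedding
  have h1 : IsClosedEmbedding fun s : ℝ => s • v := by
    have h := LinearMap.isClosedEmbedding_of_injective (f := (LinearMap.id : ℝ →ₗ[ℝ] ℝ).smulRight v)
      (LinearMap.ker_eq_bot.2 (smul_left_injective ℝ hv))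
    exact h
  have h2 : IsClosedEmbedding fun s : ℝ => s • v + y := (Homeomorph.addRight y).isClosedEmbedding.comp h1
  exact hk.hasCompactSupport.comp_isClosedEmbedding h2

/-- **The fibre integral of a test function is smooth** (a parametric integral over a fixed compact
`s`-interval). [folklore] -/
theorem contDiff_fibreIntegral [FiniteDimensional ℝ X] (hφ : φ v = 1) {k : X → ℂ} (hk : IsTestFn k) : ContDiff ℝ ∞ (fibreIntegral v φ k) := by
  -- bounds for `φ` on the support
  obtain ⟨R, hR⟩ := hk.hasCompactSupport.isCompact.exists_bound_of_continuousOn φ.continuous.continuousOn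
  have hsupp : ∀ x : X, support (fun s : ℝ => k (s • v + (x - (φ x) • v))) ⊆ Ioc (-R - 1) (R + 1) := by
    intro x s hs
    have hmem : s • v + (x - (φ x) • v) ∈ tsupport k := subset_tsupport _ hs
    have h := hR _ hmem
    rw [apply_line v φ hφ, Real.norm_eq_abs] at h
    exact ⟨by linarith [(abs_le.1 h).1], by linarith [(abs_le.1 h).2]⟩
  have heq : fibreIntegral v φ k = fun x => ∫ s in (-R - 1 : ℝ)..(R + 1),
      (fun (x : X) (s : ℝ) => k (s • v + (x - (φ x) • v))) x s := by
    funext x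
    rw [fibreIntegral, intervalIntegral.integral_eq_integral_of_support_subset (hsupp x)]
  rw [heq]
  refine Literature.Analysis.Calculus.contDiff_intervalIntegral ?_ _ _
  exact hk.contDiff.comp ((contDiff_snd.smul contDiff_const).add
    (contDiff_fst.sub ((φ.contDiff.comp contDiff_fst).smul contDiff_const)))

/-- `s v + y = (s + φ y) v + (y - (φ y) v)`: the line through `y` reparametrised from `ker φ`. [folklore] -/
theorem line_through (y : X) (s : ℝ) : s • v + y = (s + φ y) • v + (y - (φ y) • v) := by
  rw [add_smul]; abel

/-- `∫ k(s v + y) ds = A k (y)` (translation invariance of Lebesgue measure). [folklore] -/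
theorem integral_line_eq_fibreIntegral (k : X → ℂ) (y : X) :
    ∫ s : ℝ, k (s • v + y) = fibreIntegral v φ k y := by
  unfold fibreIntegral
  have h : (fun s : ℝ => k (s • v + y)) = fun s : ℝ => (fun u : ℝ => k (u • v + (y - (φ y) • v))) (s + φ y) := by
    funext s; simp only [line_through v φ y s]
  rw [h, integral_add_right_eq_self (μ := volume) (fun u : ℝ => k (u • v + (y - (φ y) • v))) (φ y)]

/-- **A fixed smooth bump on `ℝ` of integral one** (`ContDiffBump.normed`). [folklore] -/
def stdBump : ℝ → ℝ := (⟨1, 2, one_pos, one_lt_two⟩ : ContDiffBump (0 : ℝ)).normed volume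

/-- `stdBump` is smooth. [folklore] -/
theorem contDiff_stdBump : ContDiff ℝ ∞ stdBump := ContDiffBump.contDiff_normed (n := ⊤) _

/-- `stdBump` has compact support. [folklore] -/
theorem hasCompactSupport_stdBump : HasCompactSupport stdBump := ContDiffBump.hasCompactSupport_normed _

/-- `∫ stdBump = 1`. [folklore] -/
theorem integral_stdBump : ∫ s : ℝ, stdBump s = 1 := ContDiffBump.integral_normed _

/-- **The reinsertion** `r(x) = ρ(φ x) · A k (x)` of the fibre integral as a test function on `X`. [folklore] -/
def reinsert (F : X → ℂ) (x : X) : ℂ := ((stdBump (φ x) : ℝ) : ℂ) * F x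

/-- The reinsertion of the fibre integral of a test function is a test function. [folklore] -/
theorem isTestFn_reinsert_fibreIntegral [FiniteDimensional ℝ X] (hφ : φ v = 1) {k : X → ℂ} (hk : IsTestFn k) :
    IsTestFn (reinsert φ (fibreIntegral v φ k)) := by
  refine ⟨?_, ?_⟩
  · unfold reinsert
    exact (Complex.ofRealCLM.contDiff.comp (contDiff_stdBump.comp φ.contDiff)).mul (contDiff_fibreIntegral v φ hφ hk)
  · -- support inside `{t v + (z - (φ z) v) : t ∈ tsupport ρ, z ∈ tsupport k}`
    set S := (fun p : ℝ × X => p.1 • v + (p.2 - (φ p.2) • v)) '' (tsupport stdBump ×ˢ tsupport k) with hS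
    have hSc : IsCompact S := (hasCompactSupport_stdBump.isCompact.prod hk.hasCompactSupport.isCompact).image
      ((continuous_fst.smul continuous_const).add
        (continuous_snd.sub ((φ.continuous.comp continuous_snd).smul continuous_const)))
    refine IsCompact.of_isClosed_subset hSc (isClosed_tsupport _) (closure_minimal (fun x hx => ?_) hSc.isClosed)
    rw [mem_support] at hx
    unfold reinsert at hx
    have h1 : stdBump (φ x) ≠ 0 := fun h => hx (by rw [h]; simp)
    have h2 : fibreIntegral v φ k x ≠ 0 := fun h => hx (by rw [h]; simp)
    have hex : ∃ s : ℝ, k (s • v + (x - (φ x) • v)) ≠ 0 := by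
      by_contra hall
      push Not at hall
      apply h2
      unfold fibreIntegral
      simp [hall]
    obtain ⟨s, hs⟩ := hex
    refine ⟨(φ x, s • v + (x - (φ x) • v)), ⟨subset_tsupport _ h1, subset_tsupport _ hs⟩, ?_⟩
    simp only
    rw [apply_line v φ hφ x s]
    have : s • v + (x - (φ x) • v) - s • v = x - (φ x) • v := by abel
    rw [this, line_decomp]

/-- **The difference `k - r` has vanishing fibre integrals.** [folklore] -/
theorem integral_line_sub_reinsert (hφ : φ v = 1) {k : X → ℂ} (hk : IsTestFn k) (y : X) :
    ∫ s : ℝ, (k - reinsert φ (fibreIntegral v φ k)) (s • v + y) = 0 := by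
  have hky := hasCompactSupport_line v φ hφ hk y
  have hint1 : Integrable (fun s : ℝ => k (s • v + y)) := hky.1.integrable_of_hasCompactSupport hky.2
  -- the reinserted term along the line is `ρ(s + φ y) · A k (y)`
  have hre : ∀ s : ℝ, reinsert φ (fibreIntegral v φ k) (s • v + y) =
      ((stdBump (s + φ y) : ℝ) : ℂ) * fibreIntegral v φ k y := by
    intro s
    unfold reinsert
    rw [fibreIntegral_line v φ hφ, map_add, map_smul, hφ, smul_eq_mul, mul_one]
  have hρc : Continuous fun s : ℝ => ((stdBump (s + φ y) : ℝ) : ℂ) :=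
    Complex.continuous_ofReal.comp (contDiff_stdBump.continuous.comp (continuous_id.add continuous_const))
  have hρs : HasCompactSupport fun s : ℝ => ((stdBump (s + φ y) : ℝ) : ℂ) := by
    have h := hasCompactSupport_stdBump.comp_homeomorph (Homeomorph.addRight (φ y))
    exact h.comp_left Complex.ofReal_zero
  have hint2 : Integrable (fun s : ℝ => reinsert φ (fibreIntegral v φ k) (s • v + y)) := by
    simp_rw [hre]
    exact (hρc.integrable_of_hasCompactSupport hρs).mul_const _
  simp only [Pi.sub_apply]
  rw [integral_sub hint1 hint2, integral_line_eq_fibreIntegral v φ k y]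
  simp_rw [hre]
  rw [integral_mul_const]
  have hone : ∫ s : ℝ, ((stdBump (s + φ y) : ℝ) : ℂ) = 1 := by
    rw [integral_complex_ofReal]
    rw [integral_add_right_eq_self (μ := volume) stdBump (φ y), integral_stdBump]
    simp
  rw [hone, one_mul, sub_self]

/-- **(FACT) Translation-quasi-invariant finite-order functionals factor through the twisted fibre
integral.** Let `D` be additive and homogeneous on test functions, of finite order, and quasi-invariant:
`D (f(· - t v)) = e^{iλt} D f` for all test `f` and `t ∈ ℝ`. Then for every test function `f`

  `D f = D (x ↦ e^{-iλ φ(x)} ρ(φ x) · ∫ e^{iλ s} f(s v + (x - (φ x) v)) ds)`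

(`ρ = stdBump`; the inner integral is the fibre integral `A (e_λ f)`), i.e. `D f` depends only on the twisted
fibre integral of `f` along `ℝ v` — Hörmander, Thm. 3.1.4' (`∂_n u = 0 ⟹ u(φ) = ∫ u₀(φ(·, x_n)) dx_n`,
`u₀(χ) = u(χ ⊗ ψ₀)`), conjugated by `e^{iλφ}` as in Cor. 3.1.5. Proof: `k = e_λ f`, `g = k - ρ(φ) A k` has
vanishing fibre integrals, hence `g = ∂_v G` (PRIM), and `D(e_{-λ} ∂_v G) = 0` by the infinitesimal form
`D (∂_v h) = -iλ D h` of the quasi-invariance (DIFF). [cite: HormanderALPDO1, Thm. 3.1.4', Cor. 3.1.5] -/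
theorem apply_eq_apply_reinsert [FiniteDimensional ℝ X] {D : (X → ℂ) → ℂ}
    (hadd : ∀ f g : X → ℂ, IsTestFn f → IsTestFn g → D (f + g) = D f + D g)
    (hsmul : ∀ (c : ℂ) (f : X → ℂ), IsTestFn f → D (c • f) = c * D f)
    (hD : IsFiniteOrder D) (hφ : φ v = 1) {lam : ℝ}
    (hq : ∀ f : X → ℂ, IsTestFn f → ∀ t : ℝ,
      D (translate (t • v) f) = Complex.exp (((lam * t : ℝ) : ℂ) * Complex.I) * D f)
    {f : X → ℂ} (hf : IsTestFn f) :
    D f = D (fun x => twistFn φ (-lam) x *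
      reinsert φ (fibreIntegral v φ (fun y => twistFn φ lam y * f y)) x) := by
  have hsub : ∀ f g : X → ℂ, IsTestFn f → IsTestFn g → D (f - g) = D f - D g := by
    intro f g hf hg
    have h := hadd (f - g) g (hf.sub hg) hg
    rw [sub_add_cancel] at h
    linear_combination -h
  -- `k = e_λ f`, `r = ρ(φ) A k`, `g = k - r = ∂_v G`
  set k : X → ℂ := fun y => twistFn φ lam y * f y with hk
  have hkt : IsTestFn k := hf.mul_left (contDiff_twistFn φ lam)
  set r : X → ℂ := reinsert φ (fibreIntegral v φ k) with hr
  have hrt : IsTestFn r := isTestFn_reinsert_fibreIntegral v φ hφ hkt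
  obtain ⟨G, hG, hGg⟩ := exists_vecDeriv_eq_of_integral_eq_zero v φ hφ (hkt.sub hrt)
    (integral_line_sub_reinsert v φ hφ hkt)
  have hzero := apply_twist_vecDeriv_eq_zero v φ hadd hsmul hD hφ hq hG
  rw [hGg] at hzero
  -- `e_{-λ} (k - r) = f - e_{-λ} r`
  have hpt : (fun x => twistFn φ (-lam) x * (k - r) x) = f - fun x => twistFn φ (-lam) x * r x := by
    funext x
    simp only [Pi.sub_apply, hk]
    have h1 : twistFn φ (-lam) x * twistFn φ lam x = 1 := by
      rw [mul_comm]; exact twistFn_mul_twistFn_neg φ lam x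
    linear_combination (f x) * h1
  rw [hpt, hsub _ _ hf (hrt.mul_left (contDiff_twistFn φ _))] at hzero
  linear_combination hzero

/-- **(FACT), unfolded**: `D f = D (x ↦ e^{-iλ φ(x)} ρ(φ x) ∫ e^{iλ s} f(s v + (x - (φ x) v)) ds)`. [folklore] -/
theorem apply_eq_apply_twistedFibreIntegral [FiniteDimensional ℝ X] {D : (X → ℂ) → ℂ}
    (hadd : ∀ f g : X → ℂ, IsTestFn f → IsTestFn g → D (f + g) = D f + D g)
    (hsmul : ∀ (c : ℂ) (f : X → ℂ), IsTestFn f → D (c • f) = c * D f)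
    (hD : IsFiniteOrder D) (hφ : φ v = 1) {lam : ℝ}
    (hq : ∀ f : X → ℂ, IsTestFn f → ∀ t : ℝ,
      D (translate (t • v) f) = Complex.exp (((lam * t : ℝ) : ℂ) * Complex.I) * D f)
    {f : X → ℂ} (hf : IsTestFn f) :
    D f = D (fun x => Complex.exp (-(((lam * φ x : ℝ) : ℂ) * Complex.I)) * ((stdBump (φ x) : ℝ) : ℂ) *
      ∫ s : ℝ, Complex.exp (((lam * s : ℝ) : ℂ) * Complex.I) * f (s • v + (x - (φ x) • v))) := by
  rw [apply_eq_apply_reinsert v φ hadd hsmul hD hφ hq hf]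
  congr 1
  funext x
  unfold reinsert fibreIntegral
  simp_rw [twistFn_line v φ hφ lam x]
  rw [← mul_assoc]
  congr 2
  rw [twistFn]
  congr 1
  push_cast
  ring

end Fact

end Literature.Analysis.Distribution
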